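import Summits.ResolutionOfSingularities.ResolutionOfSingularities.Theorems.HilbertSamuelEliminationSigmaMaxModificationsCorridor3WLadderSegmentsBirthF
import Summits.ResolutionOfSingularities.ResolutionOfSingularities.Theorems.HilbertSamuelEliminationSigmaMaxModificationsCorridor3WLadderSegmentsBirthZeroF
import Summits.ResolutionOfSingularities.ResolutionOfSingularities.Theorems.HilbertSamuelEliminationSigmaMaxModificationsCorridor3WLadderSegmentsHEmpStrongPlus
import HarnessLib

/-!
# [OURS · L1 W4.2] RECOGNITION ASSEMBLY, STEP A, KEYED ON A POINT HYPOTHESIS `F` (the `p = 2` / `Q`-generic twin of `…SegmentsAssemblyA`):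
# (Dich⁺)/(RegN) at EVERY interior stage of a unit, hence (H-emp)U — the strong invariant `Seg.invariant_strongPlus` with its birth hypothesis
# discharged by the `F`-keyed births `Seg.dichPlus_regN_birth_zeroF` / `Seg.dichPlus_regN_birthF`
# (crux `SigmaMaxModifications` stmt-ResolutionOfSingularities-18506; conjunct `SigmaMaxModificationsCorridor3` stmt-…-19249; line `w_ladder`;
# RECOGNITION assembly, division (c′) of res-L1-w42-plan-1 RULING v3.14-24 (GD))

Pool seat res-D-pv-038 (gen 8). Helper file `--supports stmt-ResolutionOfSingularities-19249 --as helper`; kernel only, no new definition.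
The wiring is res-L1-w42-stub-1's (`…SegmentsAssemblyA`) VERBATIM with `hchar : CharHypothesis` ↦ `hF` (an arbitrary point hypothesis `F` along the
near loci of `locTower b`) and the printed (F1)-keyed binders ↦ the same statements keyed on `F` (section variables `h314f`, `hPb`, `h314`, `h314pt`,
the shapes of res-L1-w42-stub-2's `BlowupTowerNearW`).

* `Seg.invariant_of_printedFactsF`, `Seg.dich_regN_of_printedFactsF`, `Seg.hEmpU_of_printedFactsF`.

OURS bookkeeping; NOT a statement of the manuscript [Hironaka2017] nor of [CossartJannsenSaito2020]. AI-written; AI review is weaker than expert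
review.

References: V. Cossart, U. Jannsen, S. Saito, LNM 2270 (2020), Rem. 6.29, Lemma 6.33, Def. 6.34, Def. 6.38, p. 104–107, 150–160 [CossartJannsenSaito2020].
-/

noncomputable section

set_option linter.dupNamespace false -- namespace `…Corridor3.Moving` re-enters `…Corridor3` (module convention of the Moving files)

open CategoryTheory AlgebraicGeometry TopologicalSpace Topology IsLocalRing
open Literature.AlgebraicGeometry.Resolution Literature.RingTheory.HilbertSamuel
open Literature.AlgebraicGeometry.CossartJannsenSaito2020
open Summit.ResolutionOfSingularities.ResolutionOfSingularities.Theorems.CampaignW42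
open Summit.ResolutionOfSingularities.ResolutionOfSingularities.Theorems.SigmaMaxModificationsCorridor3.Helpers

namespace Summit.ResolutionOfSingularities.ResolutionOfSingularities.Theorems.SigmaMaxModificationsCorridor3.Moving.Seg

section AssemblyAF

variable {R : ∀ S : Scheme.{0}, CentreSeq S → Prop} {N : ℕ} {ν : ℕ → ℕ} {k : Type} [Field k]
  {c : ℕ → MarkedStage.{0}} (hc : ∀ n, CanonicalNearStep R N ν (c n) (c (n + 1))) (hRf : OracleFunctional R) (hRa : OracleAdmissible R)
  (hν : ν ≠ iterPSum N Phi) (h0 : Helpers.CycleInv k N ν (c 0)) (hgen : ∀ n, ∃ m, n ≤ m ∧ (c m).IsBlownUp R N ν)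
  (hBG : ∀ n, ∃ m, n ≤ m ∧ (c m).IsBlownUp R N ν ∧ Iso N (c m))
  {p : ℕ} {X : Scheme.{0}} [IsLocallyNoetherian X] {x : X} (hX : IsMaximalOrigin p N ν X x)
  (hreach : Reaches R N ν (MarkedStage.init X x) (c 0))
  (F : ∀ (X : Scheme.{0}) [IsLocallyNoetherian X], X → Prop)
  (h314f : ∀ (X X' : Scheme.{0}) [IsLocallyNoetherian X] (π : X' ⟶ X) (D : X.IdealSheafData),
    Scheme.IsExcellent X → IdealSheafData.IsPermissible D → IsBlowup π D →
      ∀ N : ℕ, topologicalKrullDim X ≤ (N : WithBot ℕ∞) →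
        ∀ x : X, x ∈ D.support → F X x →
          (Scheme.dirDim X x : WithBot ℕ∞) ≤ ringKrullDim (X.presheaf.stalk x ⧸ stalkIdeal D x) + 1 →
            {x' : X' | π.base x' = x ∧ Scheme.hsFun X' N x' = Scheme.hsFun X N x}.Subsingleton)
  (hPb : ∀ (X X' : Scheme.{0}) [IsLocallyNoetherian X] [IsLocallyNoetherian X'] (π : X' ⟶ X) (D : X.IdealSheafData),
    Scheme.IsExcellent X → IdealSheafData.IsPermissible D → IsBlowup π D →
      ∀ N : ℕ, topologicalKrullDim ↥X ≤ (N : WithBot ℕ∞) →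
        ∀ x' : X', π.base x' ∈ D.support → stalkIdeal D (π.base x') = maximalIdeal _ →
          F X (π.base x') → Scheme.dirDim X (π.base x') = 1 →
            Scheme.hsFun X' N x' = Scheme.hsFun X N (π.base x') → IsIso (π.residueFieldMap x'))
  (h314 : ∀ (X X' : Scheme.{0}) [IsLocallyNoetherian X] [IsLocallyNoetherian X'] (π : X' ⟶ X) (D : X.IdealSheafData),
    Scheme.IsExcellent X → IdealSheafData.IsPermissible D → IsBlowup π D →
      ∀ N : ℕ, topologicalKrullDim X ≤ (N : WithBot ℕ∞) →
        ∀ x' : X', π.base x' ∈ D.support → F X (π.base x') →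
          Scheme.hsFun X' N x' = Scheme.hsFun X N (π.base x') →
            ringKrullDim (X.presheaf.stalk (π.base x') ⧸ stalkIdeal D (π.base x')) <
              (Scheme.dirDim X (π.base x') : WithBot ℕ∞))
  (h314pt : ∀ (X X' : Scheme.{0}) [IsLocallyNoetherian X] (π : X' ⟶ X) (x : X) (hx : IsClosed ({x} : Set X)) (N : ℕ)
    (x' : X'), Scheme.IsExcellent X → IdealSheafData.IsPermissible (Scheme.IdealSheafData.vanishingIdeal ⟨{x}, hx⟩) →
      IsBlowup π (Scheme.IdealSheafData.vanishingIdeal ⟨{x}, hx⟩) → topologicalKrullDim ↥X ≤ (N : WithBot ℕ∞) → π.base x' = x → F X x →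
        Scheme.hsFun X' N x' = Scheme.hsFun X N x → IsOnProjDirectrix π x')

include hRf hX hreach h314f hPb h314 h314pt in
/-- **THE INVARIANT FROM THE PRINTED FACTS, keyed on a point hypothesis `F`** (twin of `Seg.invariant_of_printedFacts`): at every stage `n < relIdxU b (relLen b)` of the unit based at a blown-up `Iso` stage `b` (`F` along the near loci
of `locTower b`, `e = 2`, `ē ≤ 2`): «genuine ⇒ `N_n ⊆ C_{b+n}`», «waiting ⇒ `C_{b+n} ∩ N_n = ∅`», (Dich⁺_n), (RegN_n), and for `0 < n` one label + replay avoidance.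
[cite: CossartJannsenSaito2020, Rem. 6.29 (1), Lemma 6.33, Def. 6.34, Def. 6.38] -/
theorem invariant_of_printedFactsF (h36 : CossartJannsenSaito2020_thm_3_6.{0}) (h3104 : CossartJannsenSaito2020_thm_3_10_4.{0})
    (b : ℕ) (hb : (c b).IsBlownUp R N ν) (hiso : Iso N (c b))
    (hF : ∀ n, ∀ y ∈ (locTower hc hRa hν h0 b).nearLocus N (basePt hc hRa hν h0 b) n,
      @F ((locTower hc hRa hν h0 b).X n) ((locTower hc hRa hν h0 b).ln n) y)
    (he : dirDim (c b) = 2) (hē : (c b).geomDirDim ≤ 2) :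
    ∀ n, n < Seg.relIdxU hgen hBG b (Seg.relLen hgen hBG b) →
      (((c (b + n)).IsBlownUp R N ν → (upTower hc hRa hν h0 b).nearLocus N (c b).pt n ⊆ (upTower hc hRa hν h0 b).C n) ∧
        (¬ (c (b + n)).IsBlownUp R N ν → (upTower hc hRa hν h0 b).C n ∩ (upTower hc hRa hν h0 b).nearLocus N (c b).pt n = ∅) ∧
        ((((upTower hc hRa hν h0 b).nearLocus N (c b).pt n).Infinite ∧ IsIrreducible ((upTower hc hRa hν h0 b).nearLocus N (c b).pt n) ∧
          ∀ y ∈ (upTower hc hRa hν h0 b).nearLocus N (c b).pt n, ¬ IsGenericPoint y ((upTower hc hRa hν h0 b).nearLocus N (c b).pt n) →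
            IsClosed ({y} : Set (c (b + n)).W)) ∨
          (((upTower hc hRa hν h0 b).nearLocus N (c b).pt n).Finite ∧
            ∀ y ∈ (upTower hc hRa hν h0 b).nearLocus N (c b).pt n, IsClosed ({y} : Set (c (b + n)).W))) ∧
        (((upTower hc hRa hν h0 b).nearLocus N (c b).pt n).Infinite →
          ∀ h : IsClosed ((upTower hc hRa hν h0 b).nearLocus N (c b).pt n),
            Scheme.IsRegular (Scheme.IdealSheafData.vanishingIdeal ⟨(upTower hc hRa hν h0 b).nearLocus N (c b).pt n, h⟩).subscheme)) ∧
      (0 < n →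
        (∀ Z₁ ∈ componentsIn (Scheme.hsStratum (c (b + n)).W N ν), ∀ Z₂ ∈ componentsIn (Scheme.hsStratum (c (b + n)).W N ν),
          Z₁ ⊆ (upTower hc hRa hν h0 b).nearLocus N (c b).pt n → Z₂ ⊆ (upTower hc hRa hν h0 b).nearLocus N (c b).pt n →
            (c (b + n)).L.label Z₁ = (c (b + n)).L.label Z₂) ∧
        ∀ Q, (c (b + n)).P = some Q → Q.rest.CentresOver (Q.hom.base ⁻¹' ((upTower hc hRa hν h0 b).nearLocus N (c b).pt n)ᶜ)) := by
  obtain ⟨k', _, _, hg⟩ := hX.exists_stateGood_of_reaches hRa hν (reaches_chain hreach hc b)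
  have hU := stratumIsolated_of_iso hg hiso
  refine invariant_strongPlus hc hRf hRa hν h0 hX hreach b hb hiso (Seg.relIdxU hgen hBG b (Seg.relLen hgen hBG b)) ?_
  intro n hnM hbn hdata
  obtain ⟨L, hL⟩ := Seg.exists_relIdx_eq hgen b hbn
  subst hL
  have hmono := (BlowupTower.cidx_strictMono 0 (Seg.relGap hgen b)).monotone
  have hLlt : L < Seg.relLen hgen hBG b := by
    refine lt_of_not_ge fun hge => ?_
    have h1 : Seg.relIdx hgen b (Seg.relLen hgen hBG b) ≤ Seg.relIdx hgen b L := hmono hge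
    rw [Seg.relIdxU_eq_of_le hgen hBG b le_rfl] at hnM
    omega
  rw [show Seg.relIdx hgen b L + 1 = Seg.relIdxL hgen b L (L + 1) from (Seg.relIdxL_succ_self hgen b L).symm]
  rcases Nat.eq_zero_or_pos L with hL0 | hLpos
  · subst hL0
    exact dichPlus_regN_birth_zeroF hc hRf hRa hν h0 hgen hX hreach F h314pt b hb hiso hF he
  · -- hypotheses of the interior birth, read off the invariant data at the stages `≤ relIdx b L`
    have hempL : ∀ n, n < Seg.relIdx hgen b L → ¬ (c (b + n)).IsBlownUp R N ν → (locTower hc hRa hν h0 b).C n = ∅ := fun n hn hw =>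
      (locTower_C_eq_empty_iff hc hRa hν h0 hX hreach b hU n).mpr ((hdata n hn.le).2.1 hw)
    have hNC : ∀ i, i ≤ L → (upTower hc hRa hν h0 b).nearLocus N (c b).pt (Seg.relIdxL hgen b L i) ⊆ (upTower hc hRa hν h0 b).C (Seg.relIdxL hgen b L i) := by
      intro i hi
      rw [Seg.relIdxL_eq_of_le hgen b L hi]
      exact (hdata _ (hmono hi)).1 (Seg.B_add_relIdx hgen hb i)
    have hdL := hdata (Seg.relIdx hgen b L) le_rfl
    have hnotG : ¬ Iso N (c (b + Seg.relIdx hgen b L)) := Seg.not_G_add_relIdx_of_lt_relLen hgen hBG b hLpos hLlt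
    have hD : (((upTower hc hRa hν h0 b).nearLocus N (c b).pt (Seg.relIdx hgen b L)).Infinite ∧
          IsIrreducible ((upTower hc hRa hν h0 b).nearLocus N (c b).pt (Seg.relIdx hgen b L))) ∨
        (((upTower hc hRa hν h0 b).nearLocus N (c b).pt (Seg.relIdx hgen b L)).Finite ∧
          ∀ y ∈ (upTower hc hRa hν h0 b).nearLocus N (c b).pt (Seg.relIdx hgen b L), IsClosed ({y} : Set (c (b + Seg.relIdx hgen b L)).W)) :=
      hdL.2.2.1.imp (fun h => ⟨h.1, h.2.1⟩) id
    obtain ⟨hinf, hirr⟩ := infinite_irreducible_nearLocus_of_not_iso hc hRa hν h0 hX hreach b hU _ hnotG hD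
    have hpts : ∀ y ∈ (upTower hc hRa hν h0 b).nearLocus N (c b).pt (Seg.relIdx hgen b L),
        ¬ IsGenericPoint y ((upTower hc hRa hν h0 b).nearLocus N (c b).pt (Seg.relIdx hgen b L)) →
          IsClosed ({y} : Set (c (b + Seg.relIdx hgen b L)).W) := by
      rcases hdL.2.2.1 with h | h
      · exact h.2.2
      · exact absurd h.1 hinf
    have hinf' : ((upTower hc hRa hν h0 b).nearLocus N (c b).pt (Seg.relIdxL hgen b L L)).Infinite := by
      rw [Seg.relIdxL_eq_of_le hgen b L le_rfl]; exact hinf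
    have hirr' : IsIrreducible ((upTower hc hRa hν h0 b).nearLocus N (c b).pt (Seg.relIdxL hgen b L L)) := by
      rw [Seg.relIdxL_eq_of_le hgen b L le_rfl]; exact hirr
    have hpts' : ∀ y ∈ (upTower hc hRa hν h0 b).nearLocus N (c b).pt (Seg.relIdxL hgen b L L),
        ¬ IsGenericPoint y ((upTower hc hRa hν h0 b).nearLocus N (c b).pt (Seg.relIdxL hgen b L L)) →
          IsClosed ({y} : Set (c (b + Seg.relIdxL hgen b L L)).W) := by
      rw [Seg.relIdxL_eq_of_le hgen b L le_rfl]; exact hpts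
    exact dichPlus_regN_birthF hc hRa hν h0 hgen hX hreach F h314f hPb h314 h36 h3104 b hU hF hē L hempL hNC hinf' hirr' hpts'

include hRf hX hreach h314f hPb h314 h314pt in
/-- **(Dich)/(RegN) AT EVERY INTERIOR STAGE OF THE UNIT, FROM THE PRINTED FACTS keyed on `F`** (twin of `Seg.dich_regN_of_printedFacts`). [cite: CossartJannsenSaito2020, Lemma 6.33, Def. 6.34] -/
theorem dich_regN_of_printedFactsF (h36 : CossartJannsenSaito2020_thm_3_6.{0}) (h3104 : CossartJannsenSaito2020_thm_3_10_4.{0})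
    (b : ℕ) (hb : (c b).IsBlownUp R N ν) (hiso : Iso N (c b))
    (hF : ∀ n, ∀ y ∈ (locTower hc hRa hν h0 b).nearLocus N (basePt hc hRa hν h0 b) n,
      @F ((locTower hc hRa hν h0 b).X n) ((locTower hc hRa hν h0 b).ln n) y)
    (he : dirDim (c b) = 2) (hē : (c b).geomDirDim ≤ 2) :
    (∀ n, 0 < n → n < Seg.relIdxU hgen hBG b (Seg.relLen hgen hBG b) →
      (((upTower hc hRa hν h0 b).nearLocus N (c b).pt n).Infinite ∧ IsIrreducible ((upTower hc hRa hν h0 b).nearLocus N (c b).pt n)) ∨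
        (((upTower hc hRa hν h0 b).nearLocus N (c b).pt n).Finite ∧
          ∀ y ∈ (upTower hc hRa hν h0 b).nearLocus N (c b).pt n, IsClosed ({y} : Set (c (b + n)).W))) ∧
    (∀ n, 0 < n → n < Seg.relIdxU hgen hBG b (Seg.relLen hgen hBG b) →
      ((upTower hc hRa hν h0 b).nearLocus N (c b).pt n).Infinite →
        ∀ h : IsClosed ((upTower hc hRa hν h0 b).nearLocus N (c b).pt n),
          Scheme.IsRegular (Scheme.IdealSheafData.vanishingIdeal ⟨(upTower hc hRa hν h0 b).nearLocus N (c b).pt n, h⟩).subscheme) := by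
  have hI := invariant_of_printedFactsF hc hRf hRa hν h0 hgen hBG hX hreach F h314f hPb h314 h314pt h36 h3104 b hb hiso hF he hē
  exact ⟨fun n _ hn => (hI n hn).1.2.2.1.imp (fun h => ⟨h.1, h.2.1⟩) id, fun n _ hn => (hI n hn).1.2.2.2⟩

include hRf hX hreach h314f hPb h314 h314pt in
/-- **(H-emp)U FROM THE PRINTED FACTS keyed on `F`** (twin of `Seg.hEmpU_of_printedFacts`): in a unit based at a blown-up `Iso` stage (`F` along the
near loci of `locTower b`, `e = 2`, `ē ≤ 2`), every waiting stage strictly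
inside the unit has empty localised centre. [cite: CossartJannsenSaito2020, Rem. 6.29 (1), Def. 6.38] -/
theorem hEmpU_of_printedFactsF (h36 : CossartJannsenSaito2020_thm_3_6.{0}) (h3104 : CossartJannsenSaito2020_thm_3_10_4.{0})
    (b : ℕ) (hb : (c b).IsBlownUp R N ν) (hiso : Iso N (c b))
    (hF : ∀ n, ∀ y ∈ (locTower hc hRa hν h0 b).nearLocus N (basePt hc hRa hν h0 b) n,
      @F ((locTower hc hRa hν h0 b).X n) ((locTower hc hRa hν h0 b).ln n) y)
    (he : dirDim (c b) = 2) (hē : (c b).geomDirDim ≤ 2) : HEmpU hc hRa hν h0 hgen hBG b := by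
  obtain ⟨k', _, _, hg⟩ := hX.exists_stateGood_of_reaches hRa hν (reaches_chain hreach hc b)
  have hU := stratumIsolated_of_iso hg hiso
  have hI := invariant_of_printedFactsF hc hRf hRa hν h0 hgen hBG hX hreach F h314f hPb h314 h314pt h36 h3104 b hb hiso hF he hē
  intro n hn hw
  exact (locTower_C_eq_empty_iff hc hRa hν h0 hX hreach b hU n).mpr ((hI n hn).1.2.1 hw)

end AssemblyAF

end Summit.ResolutionOfSingularities.ResolutionOfSingularities.Theorems.SigmaMaxModificationsCorridor3.Moving.Seg

end
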